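import Summits.CriticalPhenomena.PercolationContinuityZ3.Theorems.Transplant.StatementBoxProdZ2
import Summits.CriticalPhenomena.PercolationContinuityZ3.Theorems.Transplant.BenjaminiSchrammKnownCases
import Mathlib.Combinatorics.SimpleGraph.Hasse
import Mathlib.Logic.Equiv.Fin.Basic
import HarnessLib

/-!
# `ℤ^a □ ℤ^b ≃g ℤ^{a+b}`, and the PROVED instances `X = ℤ^a` of the product target `BSConj4_boxProdZ2`

builds on p205010 (kernel theorem, internal audit signed; external expert review pending).
Status sentence (coordinator 2026-08-20T04:30Z): "θ(p_c) = 0 on ℤ^d, all d ≥ 2 — kernel-verified (Lean 4/Mathlib,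
standard axioms); internal adversarial audit SIGNED 2026-08-20 04:29Z; external expert review pending."

(The box product is written `(zdGraph a).boxProd (zdGraph b)` in this file: the `□` notation is overloaded by a category-theory import of
`BenjaminiSchrammKnownCases`.)  Lane `prim-bschramm-*`, seat `prim-bschramm-stmt`.  Non-vacuity of the AMENABLE branch of `BSConj4_boxProdZ2` (`Transplant/StatementBoxProdZ2.lean`):
the class "`X` infinite, connected, locally finite, quasi-transitive, amenable" contains `X = ℤ^a` (`a ≥ 1`), and there the target is a THEOREM of
the tree — `ℤ^a □ ℤ² ≅ ℤ^{a+2}` and `θ_{ℤ^d}(p_c) = 0` for all `d ≥ 2` builds on p205010 (kernel theorem, internal audit signed; external expert review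
pending) via `conj4_case_zd`.

* `siteAppendOrderIso a b : Site a × Site b ≃o Site (a + b)` — concatenation of coordinates (Mathlib `Fin.appendEquiv`) is an order isomorphism for
  the product / pointwise orders;
* `zdGraphProdIso a b : zdGraph a □ zdGraph b ≃g zdGraph (a + b)` — since the tree's `zdGraph d` IS Mathlib's Hasse graph of `ℤ^d` and
  `hasse (α × β) = hasse α □ hasse β` (Mathlib `SimpleGraph.hasse_prod`), an order isomorphism is a graph isomorphism;
* `theta_zdGraph_boxProdZ2_ownCritical_eq_zero a x` — **`θ_{ℤ^a □ ℤ²}((x,0), p_c(ℤ^a □ ℤ²)) = 0` for every `a` and every `x`** (transport of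
  `conj4_case_zd (a+2)` along the isomorphism; `theta_iso`, `criticalProb_iso`); `bsConj4_boxProdZ2_instance_zd` — the same read as the `X = zdGraph a`
  instance of `BSConj4_boxProdZ2` (its hypotheses hold for `a ≥ 1`: `conj4_hypotheses_witness_zd`; `Infinite (Site a)`).
[cite: KozmaNitzan2024, Thm. 6 with Conj. 3 (p. 15)] [cite: BenjaminiSchramm1996, Conj. 4]
-/

noncomputable section

namespace Summit.CriticalPhenomena.PercolationContinuityZ3.Theorems.Transplant

open MeasureTheory Literature.Probability.Percolation Literature.Probability.LatticeModels
open Literature.Barriers.CriticalPhenomena (IsQuasiTransitive)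

/-- Concatenation of coordinates is monotone for the pointwise orders. [folklore] -/
theorem fin_append_monotone (a b : ℕ) : Monotone (Fin.appendEquiv (α := ℤ) a b) := by
  intro x y hxy i
  change Fin.append x.1 x.2 i ≤ Fin.append y.1 y.2 i
  induction i using Fin.addCases with
  | left i => rw [Fin.append_left, Fin.append_left]; exact hxy.1 i
  | right j => rw [Fin.append_right, Fin.append_right]; exact hxy.2 j

/-- Splitting of coordinates is monotone for the pointwise orders. [folklore] -/
theorem fin_append_symm_monotone (a b : ℕ) : Monotone (Fin.appendEquiv (α := ℤ) a b).symm := by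
  intro f g hfg
  exact ⟨fun i => hfg (Fin.castAdd b i), fun j => hfg (Fin.natAdd a j)⟩

/-- **`ℤ^a × ℤ^b ≃o ℤ^{a+b}`** (concatenation of coordinates). [folklore] -/
def siteAppendOrderIso (a b : ℕ) : (Site a × Site b) ≃o Site (a + b) :=
  (Fin.appendEquiv a b).toOrderIso (fin_append_monotone a b) (fin_append_symm_monotone a b)

/-- `siteAppendOrderIso` acts by `Fin.append`. [folklore] -/
@[simp] theorem siteAppendOrderIso_apply (a b : ℕ) (x : Site a × Site b) : siteAppendOrderIso a b x = Fin.append x.1 x.2 := rfl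

/-- **`ℤ^a □ ℤ^b ≃g ℤ^{a+b}`**: the tree's `zdGraph d` is the Hasse graph of `ℤ^d` (`LatticeGraph.lean`), `hasse (α × β) = hasse α □ hasse β`
(Mathlib), and order isomorphisms preserve the covering relation. [cite: FriedliVelenik2017, §3.1 (the graph ℤ^d)] -/
def zdGraphProdIso (a b : ℕ) : (zdGraph a).boxProd (zdGraph b) ≃g zdGraph (a + b) where
  toEquiv := Fin.appendEquiv a b
  map_rel_iff' := by
    intro x y
    rw [← SimpleGraph.hasse_prod, SimpleGraph.hasse_adj, SimpleGraph.hasse_adj]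
    exact or_congr (apply_covBy_apply_iff (siteAppendOrderIso a b)) (apply_covBy_apply_iff (siteAppendOrderIso a b))

/-- `zdGraphProdIso` acts by `Fin.append`. [folklore] -/
@[simp] theorem zdGraphProdIso_apply (a b : ℕ) (x : Site a × Site b) : zdGraphProdIso a b x = Fin.append x.1 x.2 := rfl

/-- **`θ_{ℤ^a □ ℤ²}((x, 0), p_c(ℤ^a □ ℤ²)) = 0` for every `a` and every `x`** — the `X = ℤ^a` instances of `BSConj4_boxProdZ2` are theorems:
transport of `θ_{ℤ^{a+2}}(p_c) = 0` (every vertex; `conj4_case_zd`, builds on p205010 (kernel theorem, internal audit signed; external expert review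
pending)) along `zdGraphProdIso a 2`. [cite: KozmaNitzan2024, Thm. 6 with Conj. 3 (p. 15)] -/
theorem theta_zdGraph_boxProdZ2_ownCritical_eq_zero (a : ℕ) (x : Site a) :
    theta ((zdGraph a).boxProd (zdGraph 2)) (x, (0 : Site 2)) (criticalProbIOf ((zdGraph a).boxProd (zdGraph 2)) (x, (0 : Site 2))) = 0 := by
  set e := zdGraphProdIso a 2 with he
  have hθ : ∀ p, theta (zdGraph (a + 2)) (e (x, 0)) p = theta ((zdGraph a).boxProd (zdGraph 2)) (x, 0) p := fun p => theta_iso e (x, 0) p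
  have hpc : criticalProbIOf ((zdGraph a).boxProd (zdGraph 2)) (x, 0) = criticalProbIOf (zdGraph (a + 2)) (e (x, 0)) :=
    Subtype.ext (criticalProb_iso e (x, 0)).symm
  rw [← hθ, hpc]
  exact conj4_case_zd (a + 2) (by omega) (e (x, 0)) (conj4_hypotheses_witness_zd (a + 2) (by omega) _).2.2.2

/-- **The `X = ℤ^a` instance of `BSConj4_boxProdZ2`, in the conjecture's binder shape** (hypotheses hold for `a ≥ 1` and are not needed by the
proof). [cite: BenjaminiSchramm1996, Conj. 4] [cite: KozmaNitzan2024, Thm. 6 with Conj. 3 (p. 15)] -/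
theorem bsConj4_boxProdZ2_instance_zd (a : ℕ) :
    (zdGraph a).Connected → IsQuasiTransitive (zdGraph a) → Infinite (Site a) →
      ∀ x : Site a, theta ((zdGraph a).boxProd (zdGraph 2)) (x, (0 : Site 2)) (criticalProbIOf ((zdGraph a).boxProd (zdGraph 2)) (x, (0 : Site 2))) = 0 :=
  fun _ _ _ x => theta_zdGraph_boxProdZ2_ownCritical_eq_zero a x

/-- The hypotheses of `BSConj4_boxProdZ2` hold at `X = ℤ^a`, `a ≥ 1`: connected, `Aut`-transitive (hence quasi-transitive), infinite — so the
amenable branch of the product target is inhabited by PROVED instances. [cite: BenjaminiSchramm1996, Conj. 4 and §2] -/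
theorem boxProdZ2_zd_in_scope (a : ℕ) (ha : 1 ≤ a) :
    (zdGraph a).Connected ∧ IsQuasiTransitive (zdGraph a) ∧ Infinite (Site a) := by
  refine ⟨Literature.Barriers.CriticalPhenomena.zdGraph_connected a,
    isQuasiTransitive_of_isPretransitive (zdGraph a) 0 (isPretransitive_aut_zdGraph a), ?_⟩
  haveI : Nonempty (Fin a) := ⟨⟨0, ha⟩⟩
  exact Pi.infinite_of_right

end Summit.CriticalPhenomena.PercolationContinuityZ3.Theorems.Transplant
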